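import Mathlib
import Summits.ValiantsHypothesis.ValiantsHypothesis.Theorems.BarrierLeverPartitionMinorsHitByVPHiddenStatesSymbolic

/-!
# Route BarrierLever — item `PartitionMinorsHitByVP` (stmt-ValiantsHypothesis-19717), line `hidden-states`:
# THE TOP CO-STAR — «cube minus top», ONE legal piece with `K = h` states, is good for EVERY injective row family of size `2^h − 1`

Helper file (`--supports stmt-ValiantsHypothesis-19717`; cell valiant-natproofs, rung V4, 𝒟-side door (c), registered line
`Cruxes/PartitionMinorsHitByVP/Lines/hidden_states.lean` v7; prover seat val-np-p6 gen 10). Definition-free (two local matrix abbreviations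
inside proofs); closes NO item.

THE POINT (the DUAL of free points). At the bottom of the range, `c` affinely free members (a star) serve every `c` rows. At the top, numerics of this
seat (memo HOME/val-np-p6/g10/MEMO-valnp6-g10.md §9: h ≤ 7, all down-sets and random injective families, 0 failures) say that the CO-STAR piece
«all subsets of the `h` states except the top and `c−1` co-singletons» serves every injective family of size `2^h − c` (`c ≤ h+1`). This file PROVES
the case `c = 1` for every `h`, by the dual (Jacobi / Lagrange) mechanism rather than by cuts or tilings:

* the table is EXPLICIT and the same for all `u`: base point `𝟙`, state `q ↦ e_q`; the hidden point of the member `J` is `𝟙 + 1_J ∈ {1,2}^h`, so the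
  design matrix is a submatrix of the Kronecker power `W[S, J] = ∏_{a∈S}(1 + [a ∈ J]) = 2^{|S∩J|}` of `(1 1; 1 2)`;
* `coStar_inv_mul`: `W` has the explicit inverse `W⁻¹[J, S] = ∏_{a∈S}(±1) · ∏_{a∉S}(−1 | 2)` (Kronecker power of `(2 −1; −1 1)`, proved by `Finset.prod_add`),
  and its row at the top member `J = [h]` is `±1` in EVERY column;
* `det_coStarTop_ne_zero`: hence deleting the column `[h]` and ANY one row `S₀` from `W` leaves a nonsingular matrix (a kernel vector of the minor would
  extend to `β` with `Wβ` supported on `S₀`, so `β = (Wβ)(S₀)·W⁻¹[·,S₀]`, and `β([h]) = 0` forces `β = 0`);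
* `coStarTop_exists_table`: the `∃ tx, det ≠ 0` form for the one-piece design «all `J ≠ [h]`» against any injective `u` of size `2^h − 1`;
* **`universalJoinWide_top`**: for every `h ≥ 1` the body of `Stmt.stub_universalJoinWide` holds at `r = 2^h − 1` with `m = 1` piece and `K = h` states
  (legal strict threshold family: unit weights, the only non-member `[h]` is the heaviest set) — an all-`h` cell of the conjecture node served by a
  design that is NOT a tiling of the row family (the missing row `S₀` is arbitrary, the missing member is always the top) and NOT a cut certificate.

WHAT THIS IS NOT: only the top size `2^h − 1` (the general CO-STAR statement, `c ≤ h+1`, is a conjecture with evidence, memo §9); for the crux this co-rank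
is long unconditional (`…CorankOne`, `…Cosmall`); nothing on crux 14610 or VP ≠ VNP.
-/

set_option linter.dupNamespace false

namespace Summit.ValiantsHypothesis.ValiantsHypothesis.Theorems.BarrierLever.HiddenStates

open Finset Matrix

noncomputable section

namespace CoStar

variable {h : ℕ}

/-! ## 1. The Kronecker power `W` and its explicit inverse -/

/-- `Σ_S W⁻¹[J, S] · W[S, J'] = [J = J']` for `W[S, J'] = ∏_{a∈S}(if a ∈ J' then 2 else 1)` and
`W⁻¹[J, S] = ∏_{a∈S}(if a ∈ J then 1 else −1) · ∏_{a∉S}(if a ∈ J then −1 else 2)`. -/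
theorem coStar_inv_mul (J J' : Finset (Fin h)) :
    ∑ S : Finset (Fin h),
      ((∏ a ∈ S, (if a ∈ J then (1 : ℂ) else -1)) * (∏ a ∈ Sᶜ, (if a ∈ J then (-1 : ℂ) else 2))) *
        (∏ a ∈ S, (if a ∈ J' then (2 : ℂ) else 1))
      = if J = J' then 1 else 0 := by
  classical
  -- regroup the summand as `∏_{a∈S} f a * ∏_{a ∈ univ \ S} g a`
  have hterm : ∀ S : Finset (Fin h),
      ((∏ a ∈ S, (if a ∈ J then (1 : ℂ) else -1)) * (∏ a ∈ Sᶜ, (if a ∈ J then (-1 : ℂ) else 2))) *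
        (∏ a ∈ S, (if a ∈ J' then (2 : ℂ) else 1))
      = (∏ a ∈ S, ((if a ∈ J then (1 : ℂ) else -1) * (if a ∈ J' then (2 : ℂ) else 1))) *
        ∏ a ∈ Finset.univ \ S, (if a ∈ J then (-1 : ℂ) else 2) := by
    intro S
    rw [Finset.prod_mul_distrib, Finset.compl_eq_univ_sdiff]
    ring
  rw [Finset.sum_congr rfl fun S _ => hterm S, ← Finset.powerset_univ, ← Finset.prod_add]
  -- each factor is `[a ∈ J ↔ a ∈ J']`
  have hfac : ∀ a : Fin h, ((if a ∈ J then (1 : ℂ) else -1) * (if a ∈ J' then (2 : ℂ) else 1) +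
      (if a ∈ J then (-1 : ℂ) else 2)) = if (a ∈ J ↔ a ∈ J') then 1 else 0 := by
    intro a
    by_cases h1 : a ∈ J <;> by_cases h2 : a ∈ J' <;> simp [h1, h2] <;> norm_num
  rw [Finset.prod_congr rfl fun a _ => hfac a, Finset.prod_boole]
  by_cases hJ : J = J'
  · subst hJ; simp
  · rw [if_neg hJ, if_neg]
    intro hall
    apply hJ
    ext a
    exact hall a (Finset.mem_univ a)

/-! ## 2. Deleting the top column and any one row leaves a nonsingular matrix -/

/-- **The top co-star determinant.** Let `u` enumerate injectively `2^h − 1` subsets of `Fin h` (rows) and `c` enumerate injectively subsets all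
different from the top `univ` (columns). Then `det [∏_{a ∈ u i}(if a ∈ c k then 2 else 1)]_{i,k} ≠ 0`. -/
theorem det_coStarTop_ne_zero {r : ℕ} (u : Fin r → Finset (Fin h)) (hu : Function.Injective u)
    (c : Fin r → Finset (Fin h)) (hc : Function.Injective c) (hcu : ∀ k, c k ≠ Finset.univ) (hr : r + 1 = 2 ^ h) :
    (Matrix.of fun i k : Fin r => ∏ a ∈ u i, (if a ∈ c k then (2 : ℂ) else 1)).det ≠ 0 := by
  classical
  -- the full Kronecker power and its inverse
  let W : Matrix (Finset (Fin h)) (Finset (Fin h)) ℂ := fun S J => ∏ a ∈ S, (if a ∈ J then (2 : ℂ) else 1)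
  let Wi : Matrix (Finset (Fin h)) (Finset (Fin h)) ℂ := fun J S =>
    (∏ a ∈ S, (if a ∈ J then (1 : ℂ) else -1)) * (∏ a ∈ Sᶜ, (if a ∈ J then (-1 : ℂ) else 2))
  have hWiW : Wi * W = 1 := by
    ext J J'
    rw [Matrix.mul_apply, Matrix.one_apply]
    exact coStar_inv_mul J J'
  -- the unique row index not hit by `u`
  have hmiss : (Finset.univ \ Finset.univ.image u).card = 1 := by
    rw [Finset.card_sdiff_of_subset (Finset.subset_univ _), Finset.card_univ, Fintype.card_finset, Fintype.card_fin,
      Finset.card_image_of_injective _ hu, Finset.card_univ, Fintype.card_fin]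
    omega
  obtain ⟨S₀, hS₀⟩ := Finset.card_eq_one.mp hmiss
  have hS₀_not : ∀ i, u i ≠ S₀ := by
    intro i hi
    have : S₀ ∈ Finset.univ \ Finset.univ.image u := by rw [hS₀]; exact Finset.mem_singleton_self _
    rw [Finset.mem_sdiff] at this
    exact this.2 (Finset.mem_image.mpr ⟨i, Finset.mem_univ _, hi⟩)
  have hother : ∀ S, S ≠ S₀ → ∃ i, u i = S := by
    intro S hS
    by_contra hno
    push Not at hno
    have : S ∈ Finset.univ \ Finset.univ.image u := by
      rw [Finset.mem_sdiff]
      refine ⟨Finset.mem_univ _, fun hm => ?_⟩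
      obtain ⟨i, -, hi⟩ := Finset.mem_image.mp hm
      exact hno i hi
    rw [hS₀, Finset.mem_singleton] at this
    exact hS this
  -- suppose the minor is singular: take a kernel vector
  intro hdet
  obtain ⟨α, hαne, hα⟩ := Matrix.exists_mulVec_eq_zero_iff.mpr hdet
  -- extend it by zero to a vector on all subsets (zero at the top and at non-columns)
  let β : Finset (Fin h) → ℂ := fun J => ∑ k : Fin r, if c k = J then α k else 0
  have hβc : ∀ k, β (c k) = α k := by
    intro k
    simp only [β]
    rw [Finset.sum_eq_single k]
    · simp
    · intro k' _ hk'
      rw [if_neg]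
      exact fun hh => hk' (hc hh)
    · intro hk; exact absurd (Finset.mem_univ k) hk
  have hβtop : β Finset.univ = 0 := by
    simp only [β]
    exact Finset.sum_eq_zero fun k _ => if_neg (hcu k)
  -- `W β` vanishes on every row `u i`
  set γ : Finset (Fin h) → ℂ := W.mulVec β with hγ
  have hγu : ∀ i, γ (u i) = 0 := by
    intro i
    have hi := congrFun hα i
    simp only [Matrix.mulVec, dotProduct, Matrix.of_apply, Pi.zero_apply] at hi
    rw [hγ]
    simp only [Matrix.mulVec, dotProduct, W, β]
    rw [show (∑ J : Finset (Fin h), (∏ a ∈ u i, if a ∈ J then (2 : ℂ) else 1) * ∑ k : Fin r, (if c k = J then α k else 0))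
        = ∑ k : Fin r, (∏ a ∈ u i, if a ∈ c k then (2 : ℂ) else 1) * α k from ?_]
    · exact hi
    rw [show (∑ J : Finset (Fin h), (∏ a ∈ u i, if a ∈ J then (2 : ℂ) else 1) * ∑ k : Fin r, (if c k = J then α k else 0))
        = ∑ J : Finset (Fin h), ∑ k : Fin r, (if c k = J then (∏ a ∈ u i, if a ∈ c k then (2 : ℂ) else 1) * α k else 0) from ?_]
    · rw [Finset.sum_comm]
      refine Finset.sum_congr rfl fun k _ => ?_
      rw [Finset.sum_ite_eq Finset.univ (c k), if_pos (Finset.mem_univ _)]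
    refine Finset.sum_congr rfl fun J _ => ?_
    rw [Finset.mul_sum]
    refine Finset.sum_congr rfl fun k _ => ?_
    by_cases hk : c k = J
    · rw [if_pos hk, if_pos hk, hk]
    · rw [if_neg hk, if_neg hk, mul_zero]
  -- hence `γ` is supported on `S₀`, and `β = γ(S₀) • W⁻¹[·, S₀]`
  have hγS : ∀ S, S ≠ S₀ → γ S = 0 := by
    intro S hS
    obtain ⟨i, hi⟩ := hother S hS
    rw [← hi]; exact hγu i
  have hβ : ∀ J, β J = Wi J S₀ * γ S₀ := by
    intro J
    have h1 : (Wi.mulVec γ) J = β J := by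
      rw [hγ, Matrix.mulVec_mulVec, hWiW, Matrix.one_mulVec]
    rw [← h1, Matrix.mulVec, dotProduct]
    rw [Finset.sum_eq_single S₀]
    · intro S _ hS; rw [hγS S hS, mul_zero]
    · intro hS; exact absurd (Finset.mem_univ S₀) hS
  -- evaluate at the top: `W⁻¹[univ, S₀] = ±1 ≠ 0`
  have hWitop : Wi Finset.univ S₀ ≠ 0 := by
    simp only [Wi]
    refine mul_ne_zero (Finset.prod_ne_zero_iff.mpr fun a _ => ?_) (Finset.prod_ne_zero_iff.mpr fun a _ => ?_)
    · rw [if_pos (Finset.mem_univ a)]; exact one_ne_zero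
    · rw [if_pos (Finset.mem_univ a)]; norm_num
  have hγ0 : γ S₀ = 0 := by
    have := hβ Finset.univ
    rw [hβtop] at this
    rcases mul_eq_zero.mp this.symm with h0 | h0
    · exact absurd h0 hWitop
    · exact h0
  -- so `β = 0` and `α = 0`
  apply hαne
  funext k
  rw [Pi.zero_apply, ← hβc k, hβ, hγ0, mul_zero]

/-! ## 3. The numeric `∃ tx` form and the node at `r = 2^h − 1` -/

/-- **The top co-star serves every injective family of size `2^h − 1` (numeric form).** One piece `p₀`, `K = h` states, columns
`(p₀, c k)` with `c` injective and `c k ≠ univ`; the table «base `𝟙`, state `q ↦ e_q`» works for EVERY injective `u`. -/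
theorem coStarTop_exists_table {r m : ℕ} (p₀ : Fin m) (u : Fin r → Finset (Fin h)) (hu : Function.Injective u)
    (c : Fin r → Finset (Fin h)) (hc : Function.Injective c) (hcu : ∀ k, c k ≠ Finset.univ) (hr : r + 1 = 2 ^ h) :
    ∃ tx : Fin m → Option (Fin h) → Fin h → ℂ,
      (Matrix.of fun i k : Fin r =>
        ∏ a ∈ u i, (tx p₀ none a + ∑ q ∈ c k, tx p₀ (some q) a)).det ≠ 0 := by
  classical
  refine ⟨fun _ o a => Option.elim o (1 : ℂ) fun q => if q = a then 1 else 0, ?_⟩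
  have hentry : ∀ (k : Fin r) (a : Fin h),
      ((1 : ℂ) + ∑ q ∈ c k, (if q = a then (1 : ℂ) else 0)) = if a ∈ c k then 2 else 1 := by
    intro k a
    rw [Finset.sum_ite_eq' (c k) a]
    by_cases ha : a ∈ c k
    · rw [if_pos ha, if_pos ha]; norm_num
    · rw [if_neg ha, if_neg ha]; norm_num
  have hmat : (Matrix.of fun i k : Fin r =>
      ∏ a ∈ u i, ((1 : ℂ) + ∑ q ∈ c k, (if q = a then (1 : ℂ) else 0)))
      = Matrix.of fun i k : Fin r => ∏ a ∈ u i, (if a ∈ c k then (2 : ℂ) else 1) := by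
    ext i k
    simp only [Matrix.of_apply]
    exact Finset.prod_congr rfl fun a _ => hentry k a
  simp only [Option.elim]
  rw [hmat]
  exact det_coStarTop_ne_zero u hu c hc hcu hr

/-- **The conjecture node at the top size, for every `h`.** For `h ≥ 1` and `r = 2^h − 1` the body of `Stmt.stub_universalJoinWide`
holds with ONE piece and `K = h` states: the legal strict threshold family «all subsets of the states except the top» (unit weights) is
good for EVERY injective `u : Fin r → Finset (Fin h)`. -/
theorem universalJoinWide_top (h : ℕ) (h1 : 1 ≤ h) (r : ℕ) (hr : r + 1 = 2 ^ h) :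
    ∃ (m K : ℕ) (W : Fin m → ℕ) (wt : Fin m → Fin K → ℕ) (e : Fin r → Fin m × Finset (Fin K)),
      m ≤ h + h ∧ K ≤ h * h * h ∧ Function.Injective e ∧
      (∀ x : Fin m × Finset (Fin K), x ∉ Set.range e →
        ∀ i, W (e i).1 + ∑ k ∈ (e i).2, wt (e i).1 k < W x.1 + ∑ k ∈ x.2, wt x.1 k) ∧
      ∀ u : Fin r → Finset (Fin h), Function.Injective u →
        ∃ tx : Fin m → Option (Fin K) → Fin h → ℂ,
          (Matrix.of fun i k : Fin r =>
            ∏ a ∈ u i, (tx (e k).1 none a + ∑ q ∈ (e k).2, tx (e k).1 (some q) a)).det ≠ 0 := by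
  classical
  -- the member sets: all subsets of `Fin h` except `univ`, enumerated by `Fin r`
  set D : Finset (Finset (Fin h)) := Finset.univ.erase Finset.univ with hD
  have hDcard : D.card = r := by
    rw [hD, Finset.card_erase_of_mem (Finset.mem_univ _), Finset.card_univ, Fintype.card_finset, Fintype.card_fin]
    omega
  let ε : {x // x ∈ D} ≃ Fin r := (Finset.equivFin D).trans (finCongr hDcard)
  let c : Fin r → Finset (Fin h) := fun k => (ε.symm k).1
  have hc : Function.Injective c := by
    intro k k' hkk
    exact ε.symm.injective (Subtype.ext hkk)
  have hcu : ∀ k, c k ≠ Finset.univ := by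
    intro k hk
    have h2 : c k ∈ (Finset.univ : Finset (Finset (Fin h))).erase Finset.univ := by
      rw [← hD]; exact (ε.symm k).2
    rw [Finset.mem_erase] at h2
    exact h2.1 hk
  have hcsurj : ∀ J, J ≠ Finset.univ → ∃ k, c k = J := by
    intro J hJ
    have hJD : J ∈ D := by rw [hD, Finset.mem_erase]; exact ⟨hJ, Finset.mem_univ _⟩
    exact ⟨ε ⟨J, hJD⟩, by simp [c]⟩
  refine ⟨1, h, fun _ => 0, fun _ _ => 1, fun k => ((0 : Fin 1), c k), by omega,
    le_trans (le_trans (le_refl h) (Nat.le_mul_of_pos_right h h1)) (Nat.le_mul_of_pos_right _ h1), ?_, ?_, ?_⟩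
  · intro k k' hkk
    exact hc (congrArg Prod.snd hkk)
  · -- legality: the only non-member of the single piece is the top, of weight `h`; members weigh `|J| ≤ h − 1`
    intro x hx i
    have hx2 : x.2 = Finset.univ := by
      by_contra hne
      obtain ⟨k, hk⟩ := hcsurj x.2 hne
      apply hx
      refine ⟨k, ?_⟩
      ext1
      · exact Subsingleton.elim _ _
      · exact hk
    simp only [Finset.sum_const, smul_eq_mul, mul_one, zero_add, hx2, Finset.card_univ, Fintype.card_fin]
    have : (c i).card < h := by
      have hlt : c i ⊂ Finset.univ := Finset.ssubset_univ_iff.mpr (hcu i)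
      have := Finset.card_lt_card hlt
      rwa [Finset.card_univ, Fintype.card_fin] at this
    exact this
  · intro u hu
    exact coStarTop_exists_table (0 : Fin 1) u hu c hc hcu hr

end CoStar

end

end Summit.ValiantsHypothesis.ValiantsHypothesis.Theorems.BarrierLever.HiddenStates
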